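import Mathlib
import HarnessLib
import Summits.KontsevichZagierPeriods.KontsevichZagierPeriods.Theses.LinRedNormalForm
import Summits.KontsevichZagierPeriods.KontsevichZagierPeriods.Theorems.DihedralNormalForm.Negative.Core
import Literature.NumberTheory.Transcendental.KZLogCalculusProofs
import Literature.NumberTheory.Transcendental.KZGroundingRelations
import Literature.NumberTheory.Transcendental.NashCubes
import Literature.NumberTheory.Transcendental.BeukersZetaThreeIntegralsLegendreProofs

/-!
# `DihedralNormalForm`, line `torus-descent-sum-shadow`, stub `stub_nestedReduction` — Aux 1

Support file for the stub `stub_nestedReduction` (THEOREM N: a NESTED cubical atom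
`[□ᵏ, q·xᵃ·∏_{i≤j}(1−x_{[i,j]})^{e i j}]` is congruent modulo `KZ.relations` to a
`ℤ`-combination of word atoms, SD1-directed atoms and lower-dimensional atoms) of the crux
`DihedralNormalForm` (stmt-KontsevichZagierPeriods-3912, route `LinRedNormalForm`).

This file fixes the objects (the open cube `ocube`, the atom integrand `atomQ`, the three
generator sets `WAtom`, `SD1Atom`, `AtomLT` of the target, all written verbatim as in the
registered signature), the plumbing used in every dimension (membership constructors, disposal
of zero integrands, monomial representations — which are SD1-directed by `lam = −𝟙₀`), and the
two lowest-dimensional cases: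
* `k = 0` (`nested_zero`): the atom IS the word atom of the empty word;
* `k = 1` (`nested_one`): convergence forces `e 0 0 ≥ 0` (a letter `(1−x)^{b}`, `b < 0`, is not
  integrable: `Negative.not_integrableOn_letter`), and the polynomial `q xᵃ(1−x)ᵇ` is ONE
  multi-term integrand-additivity move away from SD1-directed monomials.
The registered sub-goal proved here is `stub_nestedReduction_le_one` (the stub for `k ≤ 1`).

References: M. Kontsevich, D. Zagier, *Periods* (2001), §1.2; F. Brown, *Mixed Tate motives
over ℤ*, Ann. of Math. 175 (2012) (the word representations).
-/

noncomputable section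

open MeasureTheory Set

namespace Summit.KontsevichZagierPeriods.DihedralNormalForm.TorusDescent

open Literature.NumberTheory.Transcendental

namespace Nested

/-! ## The sets of the statement, named -/

/-- The open unit cube `(0,1)ᵏ`, written as in the registered signature. -/
abbrev ocube (k : ℕ) : Set (Fin k → ℝ) := {x : Fin k → ℝ | ∀ i, x i ∈ Set.Ioo (0:ℝ) 1}

/-- The atom integrand `q · xᵃ · ∏_{i ≤ j} (1 − x_i⋯x_j)^{e i j}`, written as in the signature. -/
abbrev atomQ (k : ℕ) (q : ℚ) (a : Fin k → ℕ) (e : Fin k → Fin k → ℤ) (x : Fin k → ℝ) : ℝ :=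
  (q : ℝ) * ((∏ i : Fin k, x i ^ a i) * ∏ i : Fin k, ∏ j : Fin k,
    if i ≤ j then (1 - (∏ l : Fin k, if i ≤ l ∧ l ≤ j then x l else 1)) ^ e i j else 1)

/-- Word atoms of dimension `k` (the skeleton's `WAtom k`, verbatim). -/
abbrev WAtom (k : ℕ) : Set KZ.FormalRep :=
  {z : Literature.NumberTheory.Transcendental.KZ.FormalRep | ∃ (q : ℚ) (ε : Fin k → Bool) (s : Literature.NumberTheory.Transcendental.KZ.IntegralRep k), s.domain = {x : Fin k → ℝ | ∀ i, x i ∈ Set.Ioo (0:ℝ) 1} ∧ Set.EqOn s.integrand (fun x => (q : ℝ) * ((∏ i : Fin k, x i ^ (k - 1 - (i : ℕ))) * ∏ i : Fin k, if ε i then 1 / (1 - (∏ l : Fin k, if l ≤ i then x l else 1)) else 1 / (∏ l : Fin k, if l ≤ i then x l else 1))) s.domain ∧ z = Literature.NumberTheory.Transcendental.KZ.of s}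

/-- SD1-directed atoms of dimension `k` (the skeleton's `SD1Atom k`, verbatim): a direction
`lam ∈ {0,±1}ᵏ` with some `−1`, at most one `+1` in total, orthogonal to every active chord,
of non-zero total weight. -/
abbrev SD1Atom (k : ℕ) : Set KZ.FormalRep :=
  {z : Literature.NumberTheory.Transcendental.KZ.FormalRep | ∃ (q : ℚ) (a : Fin k → ℕ) (e : Fin k → Fin k → ℤ) (s : Literature.NumberTheory.Transcendental.KZ.IntegralRep k), (∃ lam : Fin k → ℤ, (∀ l : Fin k, lam l = 0 ∨ lam l = 1 ∨ lam l = -1) ∧ (∃ p : Fin k, lam p = -1) ∧ (Finset.univ.filter (fun l : Fin k => lam l = 1)).card ≤ 1 ∧ (∀ i j : Fin k, i ≤ j → e i j ≠ 0 → (∑ l : Fin k, if i ≤ l ∧ l ≤ j then lam l else 0) = 0) ∧ (∑ l : Fin k, lam l * ((a l : ℤ) + 1)) ≠ 0) ∧ s.domain = {x : Fin k → ℝ | ∀ i, x i ∈ Set.Ioo (0:ℝ) 1} ∧ Set.EqOn s.integrand (fun x => (q : ℝ) * ((∏ i : Fin k, x i ^ a i) * ∏ i : Fin k, ∏ j : Fin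 k, if i ≤ j then (1 - (∏ l : Fin k, if i ≤ l ∧ l ≤ j then x l else 1)) ^ e i j else 1)) s.domain ∧ z = Literature.NumberTheory.Transcendental.KZ.of s}

/-- Atoms of dimension `d` (the skeleton's `Atom d`, verbatim). -/
abbrev Atom (d : ℕ) : Set KZ.FormalRep :=
  {z : Literature.NumberTheory.Transcendental.KZ.FormalRep | ∃ (q : ℚ) (a : Fin d → ℕ) (e : Fin d → Fin d → ℤ) (s : Literature.NumberTheory.Transcendental.KZ.IntegralRep d), s.domain = {x : Fin d → ℝ | ∀ i, x i ∈ Set.Ioo (0:ℝ) 1} ∧ Set.EqOn s.integrand (fun x => (q : ℝ) * ((∏ i : Fin d, x i ^ a i) * ∏ i : Fin d, ∏ j : Fin d, if i ≤ j then (1 - (∏ l : Fin d, if i ≤ l ∧ l ≤ j then x l else 1)) ^ e i j else 1)) s.domain ∧ z = Literature.NumberTheory.Transcendental.KZ.of s}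

/-- Atoms of dimension `< k` (the skeleton's `AtomLT k`, verbatim). -/
abbrev AtomLT (k : ℕ) : Set KZ.FormalRep :=
  {z : Literature.NumberTheory.Transcendental.KZ.FormalRep | ∃ d : ℕ, d < k ∧ z ∈ Atom d}

/-- The target of the stub: the subgroup generated by word atoms, SD1-directed atoms and
lower-dimensional atoms. -/
abbrev Target (k : ℕ) : AddSubgroup KZ.FormalRep :=
  AddSubgroup.closure (WAtom k ∪ SD1Atom k ∪ AtomLT k)

/-! ## Plumbing -/

/-- A word atom lies in the target. -/
theorem of_mem_target_of_word {k : ℕ} (q : ℚ) (ε : Fin k → Bool) (s : KZ.IntegralRep k)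
    (hdom : s.domain = ocube k)
    (hint : EqOn s.integrand (fun x => (q : ℝ) * ((∏ i : Fin k, x i ^ (k - 1 - (i : ℕ))) *
      ∏ i : Fin k, if ε i then 1 / (1 - (∏ l : Fin k, if l ≤ i then x l else 1))
        else 1 / (∏ l : Fin k, if l ≤ i then x l else 1))) s.domain) :
    KZ.of s ∈ Target k :=
  AddSubgroup.subset_closure (Or.inl (Or.inl ⟨q, ε, s, hdom, hint, rfl⟩))

/-- An SD1-directed atom lies in the target. -/
theorem of_mem_target_of_sd1 {k : ℕ} (q : ℚ) (a : Fin k → ℕ) (e : Fin k → Fin k → ℤ)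
    (s : KZ.IntegralRep k) (lam : Fin k → ℤ)
    (h1 : ∀ l : Fin k, lam l = 0 ∨ lam l = 1 ∨ lam l = -1) (h2 : ∃ p : Fin k, lam p = -1)
    (hc : (Finset.univ.filter (fun l : Fin k => lam l = 1)).card ≤ 1)
    (h3 : ∀ i j : Fin k, i ≤ j → e i j ≠ 0 → (∑ l : Fin k, if i ≤ l ∧ l ≤ j then lam l else 0) = 0)
    (h4 : (∑ l : Fin k, lam l * ((a l : ℤ) + 1)) ≠ 0) (hdom : s.domain = ocube k)
    (hint : EqOn s.integrand (atomQ k q a e) s.domain) :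
    KZ.of s ∈ Target k :=
  AddSubgroup.subset_closure
    (Or.inl (Or.inr ⟨q, a, e, s, ⟨lam, h1, h2, hc, h3, h4⟩, hdom, hint, rfl⟩))

/-- A lower-dimensional atom lies in the target. -/
theorem of_mem_target_of_lt {k d : ℕ} (hd : d < k) (q : ℚ) (a : Fin d → ℕ) (e : Fin d → Fin d → ℤ)
    (s : KZ.IntegralRep d) (hdom : s.domain = ocube d)
    (hint : EqOn s.integrand (atomQ d q a e) s.domain) :
    KZ.of s ∈ Target k :=
  AddSubgroup.subset_closure (Or.inr ⟨d, hd, q, a, e, s, hdom, hint, rfl⟩)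

/-- Disposal of zero integrands: if the atom's coefficient vanishes, `m = 0` does it. -/
theorem goal_of_q_zero {k : ℕ} (a : Fin k → ℕ) (e : Fin k → Fin k → ℤ) (s : KZ.IntegralRep k)
    (hint : EqOn s.integrand (atomQ k 0 a e) s.domain) :
    ∃ m ∈ Target k, KZ.of s - m ∈ KZ.relations := by
  refine ⟨0, zero_mem _, ?_⟩
  rw [sub_zero]
  exact KZ.of_mem_relations_of_eqOn_zero s fun x hx => by simp [hint hx, atomQ]

/-- The open cube is the tree's `openUnitCube`. -/
theorem ocube_eq_openUnitCube (k : ℕ) : ocube k = openUnitCube k := rfl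

/-- The open cube is `ℚ`-semialgebraic. -/
theorem isSemialgebraic_ocube (k : ℕ) :
    Literature.ModelTheory.ExponentialFields.IsSemialgebraic ℚ (ocube k) :=
  isSemialgebraic_openUnitCube

/-- The open cube is measurable. -/
theorem measurableSet_ocube (k : ℕ) : MeasurableSet (ocube k) := Beukers.measurableSet_cube k

/-- The open cube has volume `1`. -/
theorem volume_ocube (k : ℕ) : volume (ocube k) = 1 := by
  rw [show ocube k = {p : Fin k → ℝ | ∀ i, p i ∈ Ioo (0 : ℝ) 1} from rfl,
    Beukers.setOf_forall_mem_Ioo_eq_pi, volume_pi_pi]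
  simp

/-- A function bounded on the open cube and measurable is integrable there. -/
theorem integrableOn_ocube_of_bound {k : ℕ} {f : (Fin k → ℝ) → ℝ} (hf : Measurable f) (M : ℝ)
    (hM : ∀ x ∈ ocube k, |f x| ≤ M) : IntegrableOn f (ocube k) := by
  refine Measure.integrableOn_of_bounded (M := M) ?_ hf.aestronglyMeasurable ?_
  · rw [volume_ocube]; exact ENNReal.one_ne_top
  · exact ae_restrict_of_forall_mem (measurableSet_ocube k) fun x hx => by
      rw [Real.norm_eq_abs]; exact hM x hx

/-- On the open cube a monomial is bounded by `1` in absolute value. -/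
theorem abs_prod_pow_le_one {k : ℕ} (n : Fin k → ℕ) {x : Fin k → ℝ} (hx : x ∈ ocube k) :
    |∏ i, x i ^ n i| ≤ 1 := by
  rw [Finset.abs_prod]
  refine Finset.prod_le_one (fun i _ => abs_nonneg _) fun i _ => ?_
  rw [abs_pow]
  exact pow_le_one₀ (abs_nonneg _) (by rw [abs_of_pos (hx i).1]; exact (hx i).2.le)

/-- **Monomial representations** `[□ᵏ, c · ∏ xᵢ^{nᵢ}]` on the open cube (polynomial integrand,
bounded, hence absolutely convergent). -/
def monoRep (k : ℕ) (c : ℚ) (n : Fin k → ℕ) : KZ.IntegralRep k where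
  domain := ocube k
  integrand := fun x => (c : ℝ) * ∏ i, x i ^ n i
  isSemialgebraic_domain := isSemialgebraic_ocube k
  isSemialgebraicFunOn_integrand := by
    refine (isSemialgebraicFunOn_aeval (isSemialgebraic_ocube k)
      (MvPolynomial.C c * ∏ i, MvPolynomial.X i ^ n i)).congr fun x _ => ?_
    simp
  integrableOn := by
    refine integrableOn_ocube_of_bound (by fun_prop) |(c : ℝ)| fun x hx => ?_
    rw [abs_mul]
    exact mul_le_of_le_one_right (abs_nonneg _) (abs_prod_pow_le_one n hx)

/-- The domain of a monomial representation. -/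
@[simp] theorem monoRep_domain (k : ℕ) (c : ℚ) (n : Fin k → ℕ) :
    (monoRep k c n).domain = ocube k := rfl

/-- The integrand of a monomial representation. -/
@[simp] theorem monoRep_integrand (k : ℕ) (c : ℚ) (n : Fin k → ℕ) :
    (monoRep k c n).integrand = fun x => (c : ℝ) * ∏ i, x i ^ n i := rfl

/-- A monomial representation is the atom with exponents `n` and no chords (`e = 0`). -/
theorem monoRep_eqOn_atomQ (k : ℕ) (c : ℚ) (n : Fin k → ℕ) :
    EqOn (monoRep k c n).integrand (atomQ k c n (fun _ _ => 0)) (monoRep k c n).domain := by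
  intro x _
  simp [atomQ]

/-- **Monomials are SD1-directed** (for `k ≥ 1`): `lam = −𝟙₀` is a descent direction of an atom
with no active chord (no `+1` coordinate at all, `E = −(n₀ + 1) ≠ 0`); so a monomial
representation lies in the target. -/
theorem of_monoRep_mem_target {k : ℕ} (hk : 0 < k) (c : ℚ) (n : Fin k → ℕ) :
    KZ.of (monoRep k c n) ∈ Target k := by
  set i₀ : Fin k := ⟨0, hk⟩
  refine of_mem_target_of_sd1 c n (fun _ _ => 0) (monoRep k c n)
    (fun l => if l = i₀ then -1 else 0) (fun l => ?_) ⟨i₀, by simp⟩ ?_ (fun i j _ h => absurd rfl h)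
    ?_ rfl (monoRep_eqOn_atomQ k c n)
  · by_cases h : l = i₀ <;> simp [h]
  · refine le_trans (Finset.card_eq_zero.mpr ?_).le zero_le_one
    refine Finset.filter_eq_empty_iff.mpr fun l _ => ?_
    by_cases h : l = i₀ <;> simp [h]
  · rw [Finset.sum_eq_single i₀ (fun l _ hl => by simp [hl]) (fun h => absurd (Finset.mem_univ _) h)]
    simp only [if_true]
    have : (0 : ℤ) < (n i₀ : ℤ) + 1 := by positivity
    nlinarith

/-! ## `k = 0`: the atom is the word atom of dimension `0` -/

/-- **Case `k = 0`.** `[pt, q]` is the word atom of dimension `0` (empty word), so it lies in the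
target as itself. -/
theorem nested_zero (q : ℚ) (a : Fin 0 → ℕ) (e : Fin 0 → Fin 0 → ℤ) (s : KZ.IntegralRep 0)
    (hdom : s.domain = ocube 0) (hint : EqOn s.integrand (atomQ 0 q a e) s.domain) :
    ∃ m ∈ Target 0, KZ.of s - m ∈ KZ.relations := by
  refine ⟨KZ.of s, of_mem_target_of_word q (fun _ => true) s hdom ?_, by simp⟩
  intro x hx
  have := hint hx
  simpa [atomQ] using this

/-! ## `k = 1`: binomial expansion into directed monomials -/

/-- On dimension `1` the atom integrand is `q · x₀^{a 0} · (1 − x₀)^{e 0 0}`. -/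
theorem atomQ_one (q : ℚ) (a : Fin 1 → ℕ) (e : Fin 1 → Fin 1 → ℤ) (x : Fin 1 → ℝ) :
    atomQ 1 q a e x = (q : ℝ) * (x 0 ^ a 0 * (1 - x 0) ^ e 0 0) := by
  simp [atomQ]

/-- `x₀ᵃ (1 − x₀)ᵇ` with `b < 0` is NOT integrable on `(0,1)`: otherwise the letter `1/(1 − x₀)`,
which is bounded by `2` on `{x₀ ≤ ½}` and by `2ᵃ · x₀ᵃ(1−x₀)ᵇ` on `{½ < x₀}`, would be integrable,
contradicting the tree's `Negative.not_integrableOn_letter`. -/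
theorem not_integrableOn_one (a : ℕ) {b : ℤ} (hb : b < 0) :
    ¬ IntegrableOn (fun x : Fin 1 → ℝ => x 0 ^ a * (1 - x 0) ^ b) (ocube 1) := by
  intro h
  have hmeas : Measurable fun x : Fin 1 → ℝ => 1 / (1 - x 0) := by fun_prop
  have key : IntegrableOn (fun x : Fin 1 → ℝ => 1 / (1 - x 0)) (ocube 1) := by
    have hA : IntegrableOn (fun x : Fin 1 → ℝ => 1 / (1 - x 0)) (ocube 1 ∩ {x | x 0 ≤ 1 / 2}) := by
      refine Measure.integrableOn_of_bounded (M := 2) ?_ hmeas.aestronglyMeasurable ?_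
      · exact ((measure_mono inter_subset_left).trans_lt
          (by rw [volume_ocube]; exact ENNReal.one_lt_top)).ne
      · refine ae_restrict_of_forall_mem
          ((measurableSet_ocube 1).inter (measurableSet_le (by fun_prop) (by fun_prop)))
          fun x hx => ?_
        have hxle : x 0 ≤ 1 / 2 := hx.2
        have h1 : 1 / 2 ≤ 1 - x 0 := by linarith
        rw [Real.norm_eq_abs, abs_of_pos (by positivity)]
        rw [div_le_iff₀ (by linarith)]
        linarith
    have hB : IntegrableOn (fun x : Fin 1 → ℝ => 1 / (1 - x 0)) (ocube 1 ∩ {x | 1 / 2 < x 0}) := by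
      have h' : IntegrableOn (fun x : Fin 1 → ℝ => (2 : ℝ) ^ a * ‖x 0 ^ a * (1 - x 0) ^ b‖)
          (ocube 1 ∩ {x | 1 / 2 < x 0}) :=
        ((h.mono_set (inter_subset_left (t := {x : Fin 1 → ℝ | 1 / 2 < x 0}))).norm).const_mul _
      refine Integrable.mono' h' hmeas.aestronglyMeasurable ?_
      refine ae_restrict_of_forall_mem
        ((measurableSet_ocube 1).inter (measurableSet_lt (by fun_prop) (by fun_prop)))
        fun x hx => ?_
      have hx0 : 0 < x 0 := (hx.1 0).1
      have hx1 : x 0 < 1 := (hx.1 0).2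
      have hxh : 1 / 2 < x 0 := hx.2
      have h1 : 0 < 1 - x 0 := by linarith
      rw [Real.norm_eq_abs, abs_of_pos (by positivity), Real.norm_eq_abs,
        abs_of_pos (by positivity)]
      have h2 : 1 / (1 - x 0) ≤ (1 - x 0) ^ b := by
        rw [one_div, ← zpow_neg_one]
        exact zpow_le_zpow_right_of_le_one₀ h1 (by linarith) (by omega)
      have h3 : (1 : ℝ) ≤ 2 ^ a * x 0 ^ a := by
        rw [← mul_pow]
        exact one_le_pow₀ (by linarith)
      calc 1 / (1 - x 0) ≤ 1 * (1 - x 0) ^ b := by rw [one_mul]; exact h2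
        _ ≤ (2 ^ a * x 0 ^ a) * (1 - x 0) ^ b :=
            mul_le_mul_of_nonneg_right h3 (zpow_nonneg h1.le _)
        _ = 2 ^ a * (x 0 ^ a * (1 - x 0) ^ b) := by ring
    have hsplit : ocube 1 = (ocube 1 ∩ {x | x 0 ≤ 1 / 2}) ∪ (ocube 1 ∩ {x | 1 / 2 < x 0}) := by
      rw [← inter_union_distrib_left]
      refine (inter_eq_left.mpr fun x _ => ?_).symm
      exact (le_or_gt (x 0) (1 / 2)).imp id id
    rw [hsplit]
    exact hA.union hB
  refine Negative.not_integrableOn_letter true ?_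
  have hset : Negative.simplex 1 = ocube 1 := by
    rw [Negative.simplex_one]
    ext t
    simp [Fin.forall_fin_one]
  rw [hset]
  simpa using key

/-- The binomial identity behind the `k = 1` split:
`x^a (1 − x)^n = Σ_{j ≤ n} C(n,j) (−1)^j x^{a+j}`. -/
theorem pow_mul_one_sub_pow (x : ℝ) (a n : ℕ) :
    x ^ a * (1 - x) ^ n =
      ∑ j ∈ Finset.range (n + 1), ((n.choose j : ℝ) * (-1) ^ j) * x ^ (a + j) := by
  have h : (1 - x) ^ n = ∑ j ∈ Finset.range (n + 1), (-x) ^ j * (n.choose j : ℝ) := by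
    rw [sub_eq_add_neg, add_comm, add_pow]
    refine Finset.sum_congr rfl fun j _ => ?_
    rw [one_pow, mul_one]
  rw [h, Finset.mul_sum]
  refine Finset.sum_congr rfl fun j _ => ?_
  rw [neg_pow, pow_add]
  ring

/-- **Case `k = 1`.** An atom `[□¹, q x₀ᵃ(1−x₀)ᵇ]` with `q = 0` is a relation; otherwise
convergence forces `b = e 0 0 ≥ 0`, and ONE multi-term integrand-additivity move
(`KZ.of_sub_sum_integrand_mem_relations`) splits it into the monomials
`[□¹, q C(b,j)(−1)ʲ x₀^{a+j}]`, each an SD1-directed atom (`lam = (−1)`, `E = −(a+j+1)`). -/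
theorem nested_one (q : ℚ) (a : Fin 1 → ℕ) (e : Fin 1 → Fin 1 → ℤ) (s : KZ.IntegralRep 1)
    (hdom : s.domain = ocube 1) (hint : EqOn s.integrand (atomQ 1 q a e) s.domain) :
    ∃ m ∈ Target 1, KZ.of s - m ∈ KZ.relations := by
  by_cases hq : q = 0
  · subst hq; exact goal_of_q_zero a e s hint
  -- convergence forces `0 ≤ e 0 0`
  have hb : 0 ≤ e 0 0 := by
    by_contra hlt
    refine not_integrableOn_one (a 0) (not_le.mp hlt) ?_
    have h1 : IntegrableOn (atomQ 1 q a e) (ocube 1) :=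
      hdom ▸ s.integrableOn.congr_fun hint (KZ.IntegralRep.measurableSet_domain_holds s)
    refine IntegrableOn.congr_fun (h1.const_mul ((q : ℝ)⁻¹)) (fun x _ => ?_) (measurableSet_ocube 1)
    have hq' : (q : ℝ) ≠ 0 := by exact_mod_cast hq
    rw [atomQ_one, ← mul_assoc, inv_mul_cancel₀ hq', one_mul]
  obtain ⟨n, hn⟩ : ∃ n : ℕ, e 0 0 = n := ⟨(e 0 0).toNat, (Int.toNat_of_nonneg hb).symm⟩
  -- the monomial representations of the binomial expansion
  let c : ℕ → ℚ := fun j => q * ((n.choose j : ℚ) * (-1) ^ j)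
  let R : ℕ → KZ.IntegralRep 1 := fun j => monoRep 1 (c j) (fun _ => a 0 + j)
  have hrel : KZ.of s - ∑ j ∈ Finset.range (n + 1), KZ.of (R j) ∈ KZ.relations := by
    refine KZ.of_sub_sum_integrand_mem_relations (Finset.range (n + 1)) R s
      (fun j _ => by rw [hdom]; rfl) fun x hx => ?_
    rw [hint hx, atomQ_one, hn, zpow_natCast, pow_mul_one_sub_pow, Finset.mul_sum]
    refine Finset.sum_congr rfl fun j _ => ?_
    simp only [R, c, monoRep_integrand, Fin.prod_univ_one]
    push_cast
    ring
  refine ⟨∑ j ∈ Finset.range (n + 1), KZ.of (R j), ?_, hrel⟩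
  exact sum_mem fun j _ => of_monoRep_mem_target Nat.one_pos (c j) fun _ => a 0 + j

end Nested

/-- **Registered sub-goal `stub_nestedReduction_le_one`**: the stub `stub_nestedReduction` in
dimension `k ≤ 1` (the nestedness hypothesis is vacuous there): dispatch to `Nested.nested_zero`,
`Nested.nested_one`. -/
theorem stub_nestedReduction_le_one : ∀ (k : ℕ), k ≤ 1 → ∀ (q : ℚ) (a : Fin k → ℕ) (e : Fin k → Fin k → ℤ) (s : Literature.NumberTheory.Transcendental.KZ.IntegralRep k), s.domain = {x : Fin k → ℝ | ∀ i, x i ∈ Set.Ioo (0:ℝ) 1} → Set.EqOn s.integrand (fun x => (q : ℝ) * ((∏ i : Fin k, x i ^ a i) * ∏ i : Fin k, ∏ j : Fin k, if i ≤ j then (1 - (∏ l : Fin k, if i ≤ l ∧ l ≤ j then x l else 1)) ^ e i j else 1)) s.domain → (∀ i j i' j' : Fin k, i < j → i' < j' → e i j ≠ 0 → e i' j' ≠ 0 → (i ≤ i' ∧ j' ≤ j) ∨ (i' ≤ i ∧ j ≤ j')) → ∃ m ∈ AddSubgroup.closure ({z : Literature.NumberTheory.Transcendental.KZ.FormalRep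 | ∃ (q : ℚ) (ε : Fin k → Bool) (s : Literature.NumberTheory.Transcendental.KZ.IntegralRep k), s.domain = {x : Fin k → ℝ | ∀ i, x i ∈ Set.Ioo (0:ℝ) 1} ∧ Set.EqOn s.integrand (fun x => (q : ℝ) * ((∏ i : Fin k, x i ^ (k - 1 - (i : ℕ))) * ∏ i : Fin k, if ε i then 1 / (1 - (∏ l : Fin k, if l ≤ i then x l else 1)) else 1 / (∏ l : Fin k, if l ≤ i then x l else 1))) s.domain ∧ z = Literature.NumberTheory.Transcendental.KZ.of s} ∪ {z : Literature.NumberTheory.Transcendental.KZ.FormalRep | ∃ (q : ℚ) (a : Fin k → ℕ) (e : Fin k → Fin k → ℤ) (s : Literature.NumberTheory.Transcendental.KZ.IntegralRep k), (∃ lam : Fin k → ℤ, (∀ l : Fin k, lam l = 0 ∨ lam l = 1 ∨ lam l = -1) ∧ (∃ p : Fin k, lam p = -1) ∧ (Finset.univ.filter (fun l : Fin k => lam l = 1)).card ≤ 1 ∧ (∀ i j : Fin k, i ≤ j → e i j ≠ 0 → (∑ l : Fin k, if i ≤ l ∧ l ≤ j then lam l else 0) = 0) ∧ (∑ l : Fin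 k, lam l * ((a l : ℤ) + 1)) ≠ 0) ∧ s.domain = {x : Fin k → ℝ | ∀ i, x i ∈ Set.Ioo (0:ℝ) 1} ∧ Set.EqOn s.integrand (fun x => (q : ℝ) * ((∏ i : Fin k, x i ^ a i) * ∏ i : Fin k, ∏ j : Fin k, if i ≤ j then (1 - (∏ l : Fin k, if i ≤ l ∧ l ≤ j then x l else 1)) ^ e i j else 1)) s.domain ∧ z = Literature.NumberTheory.Transcendental.KZ.of s} ∪ {z : Literature.NumberTheory.Transcendental.KZ.FormalRep | ∃ d : ℕ, d < k ∧ z ∈ {z : Literature.NumberTheory.Transcendental.KZ.FormalRep | ∃ (q : ℚ) (a : Fin d → ℕ) (e : Fin d → Fin d → ℤ) (s : Literature.NumberTheory.Transcendental.KZ.IntegralRep d), s.domain = {x : Fin d → ℝ | ∀ i, x i ∈ Set.Ioo (0:ℝ) 1} ∧ Set.EqOn s.integrand (fun x => (q : ℝ) * ((∏ i : Fin d, x i ^ a i) * ∏ i : Fin d, ∏ j : Fin d, if i ≤ j then (1 - (∏ l : Fin d, if i ≤ l ∧ l ≤ j then x l else 1)) ^ e i j else 1)) s.domain ∧ z = Literature.NumberTheory.Transcendental.KZ.of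 s}}), Literature.NumberTheory.Transcendental.KZ.of s - m ∈ Literature.NumberTheory.Transcendental.KZ.relations := by
  intro k hk q a e s hdom hint _
  interval_cases k
  · exact Nested.nested_zero q a e s hdom hint
  · exact Nested.nested_one q a e s hdom hint

end Summit.KontsevichZagierPeriods.DihedralNormalForm.TorusDescent
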